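import Mathlib.RingTheory.DedekindDomain.Different
import Mathlib.RingTheory.IntegralClosure.IntegralRestrict
import Mathlib.NumberTheory.RamificationInertia.Galois
import Mathlib.NumberTheory.NumberField.Basic
import Literature.NumberTheory.NumberFields.DifferentIdealIntBase
import HarnessLib

/-!
# Galois invariance of the different ideal and of its exponents

Classical Dedekind theory (Serre, *Local Fields*, Ch. III §4; Neukirch, *Algebraic Number Theory*,
Ch. III §2): in the AKLB setting (`A` integrally closed with fraction field `K`, `L/K` finite separable,
`B` the integral closure of `A` in `L`, a Dedekind domain), every `K`-automorphism `σ` of `L` restricts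
to an `A`-automorphism of `B` (Mathlib `galRestrict`), and the different `𝔇_{B/A}` — defined through
the trace form, which `σ` preserves — is carried to itself:

* `map_galRestrict_differentIdeal` : `σ(𝔇_{B/A}) = 𝔇_{B/A}`;
* `emultiplicity_differentIdeal_map_galRestrict` / `multiplicity_differentIdeal_map_galRestrict` :
  the exponent of `𝔇_{B/A}` at `σ(P)` equals its exponent at `P`, for every ideal `P` of `B`.

For number fields `F ⊆ K` with `K/F` Galois the places of `K` over a fixed place of `F` are conjugate
(Mathlib `Ideal.exists_smul_eq_of_isGaloisGroup`), whence

* `multiplicity_differentIdeal_eq_of_under_eq` : `ord_w(𝔇_{K/F}) = ord_{w'}(𝔇_{K/F})` whenever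
  `w ∩ 𝓞_F = w' ∩ 𝓞_F`;
* `multiplicity_absDifferent_eq_of_under_eq` : the same for the ABSOLUTE different `𝔇_{K/ℤ}` (every
  `σ ∈ Aut(K/F)` is an automorphism of `K/ℚ`; `𝔇_{K/ℤ} = 𝔇_{𝓞K/𝓞ℚ}`,
  `differentIdeal_int_eq_differentIdeal_ringOfIntegers_rat`).

These are the inputs for reading the local different term `d_I = Σ_i d(K_{v̲_i})` of [IUTchIV]
Thm. 1.10, Step (v) (Mochizuki, kurims p. 28: "`β_e := log(𝔡^K_v) − …`") over a CHOSEN section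
`v ↦ v̲` of the places of a Galois extension `K/F_mod` ([IUTchI] Rmk. 3.1.5): the exponent does not
depend on the choice. Theorems only; classical; nothing here bears on [IUTchIII] Cor. 3.12.
-/

open scoped nonZeroDivisors Pointwise

open Algebra

namespace Literature.NumberTheory.NumberFields

/-! ## The AKLB setting: `σ(𝔇_{B/A}) = 𝔇_{B/A}` -/

section AKLB

variable (A K L B : Type*) [CommRing A] [IsDomain A] [IsIntegrallyClosed A] [Field K]
  [Algebra A K] [IsFractionRing A K] [CommRing B] [IsDedekindDomain B] [Field L] [Algebra B L]
  [IsFractionRing B L] [Algebra A B] [Module.IsTorsionFree A B] [Algebra K L] [Algebra A L]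
  [IsScalarTower A K L] [IsScalarTower A B L] [FiniteDimensional K L] [Algebra.IsSeparable K L]
  [IsIntegralClosure B A L]

omit [Module.IsTorsionFree A B] in
/-- The codifferent (dual of `B` for the trace form) is stable under every `σ ∈ Aut(L/K)`: if
`Tr_{L/K}(y·b) ∈ A` for all `b ∈ B`, then the same holds for `σ(y)` (the trace is `σ`-invariant and
`σ⁻¹(B) = B`). [cite: SerreLocalFields1979, Ch. III §4 Prop. 8] -/
theorem mem_dual_one_of_mem_dual_one (σ : L ≃ₐ[K] L) {y : L}
    (hy : y ∈ FractionalIdeal.dual A K (1 : FractionalIdeal B⁰ L)) :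
    σ y ∈ FractionalIdeal.dual A K (1 : FractionalIdeal B⁰ L) := by
  have h1 : (1 : FractionalIdeal B⁰ L) ≠ 0 := one_ne_zero
  rw [FractionalIdeal.mem_dual h1] at hy ⊢
  intro a ha
  obtain ⟨b, rfl⟩ := (FractionalIdeal.mem_one_iff B⁰).mp ha
  -- `Tr(σ y · b) = Tr(σ (y · σ⁻¹ b)) = Tr(y · σ⁻¹ b)` and `σ⁻¹ b ∈ B`
  have hb' : algebraMap B L (galRestrict A K L B σ.symm b) = σ.symm (algebraMap B L b) :=
    algebraMap_galRestrict_apply A σ.symm b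
  have hmem : algebraMap B L (galRestrict A K L B σ.symm b) ∈ (1 : FractionalIdeal B⁰ L) :=
    FractionalIdeal.coe_mem_one B⁰ _
  have key := hy _ hmem
  rw [Algebra.traceForm_apply] at key ⊢
  have : σ y * algebraMap B L b = σ (y * algebraMap B L (galRestrict A K L B σ.symm b)) := by
    rw [map_mul, hb', AlgEquiv.apply_symm_apply]
  rw [this, Algebra.trace_eq_of_algEquiv]
  exact key

/-- `σ(𝔇_{B/A}) ⊆ 𝔇_{B/A}` elementwise: the different is stable under `galRestrict σ` for every
`σ ∈ Aut(L/K)`. [cite: SerreLocalFields1979, Ch. III §4 Prop. 8] -/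
theorem galRestrict_mem_differentIdeal (σ : L ≃ₐ[K] L) {x : B} (hx : x ∈ differentIdeal A B) :
    galRestrict A K L B σ x ∈ differentIdeal A B := by
  have h1 : (1 : FractionalIdeal B⁰ L) ≠ 0 := one_ne_zero
  have hd : FractionalIdeal.dual A K (1 : FractionalIdeal B⁰ L) ≠ 0 :=
    FractionalIdeal.dual_ne_zero A K h1
  -- membership in `𝔇` read in `L`: `x ∈ 𝔇 ↔ algebraMap x ∈ (dual 1)⁻¹`
  have hmem : ∀ z : B, z ∈ differentIdeal A B ↔
      algebraMap B L z ∈ ((differentIdeal A B : Ideal B) : FractionalIdeal B⁰ L) := by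
    intro z
    rw [FractionalIdeal.mem_coeIdeal]
    constructor
    · exact fun hz => ⟨z, hz, rfl⟩
    · rintro ⟨z', hz', h⟩
      rwa [← IsFractionRing.injective B L h]
  rw [hmem, coeIdeal_differentIdeal A K L B, FractionalIdeal.mem_inv_iff hd] at hx ⊢
  intro y hy
  -- pull `y` back by `σ`, use `hx`, push forward
  have hy' := mem_dual_one_of_mem_dual_one A K L B σ.symm hy
  obtain ⟨b, hb⟩ := (FractionalIdeal.mem_one_iff B⁰).mp (hx _ hy')
  refine (FractionalIdeal.mem_one_iff B⁰).mpr ⟨galRestrict A K L B σ b, ?_⟩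
  rw [algebraMap_galRestrict_apply, hb, map_mul, AlgEquiv.apply_symm_apply,
    algebraMap_galRestrict_apply]

/-- **Galois invariance of the different**: `σ(𝔇_{B/A}) = 𝔇_{B/A}` for every `σ ∈ Aut(L/K)`, as an
equality of ideals of `B` (pushforward along `galRestrict σ`).
[cite: SerreLocalFields1979, Ch. III §4 Prop. 8] -/
theorem map_galRestrict_differentIdeal (σ : L ≃ₐ[K] L) :
    (differentIdeal A B).map (galRestrict A K L B σ) = differentIdeal A B := by
  -- `⊆` for every `σ`
  have hle : ∀ τ : L ≃ₐ[K] L, (differentIdeal A B).map (galRestrict A K L B τ) ≤ differentIdeal A B := by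
    intro τ
    rw [Ideal.map_le_iff_le_comap]
    intro x hx
    exact galRestrict_mem_differentIdeal A K L B τ hx
  refine le_antisymm (hle σ) ?_
  -- `⊇`: `𝔇 = σ(σ⁻¹(𝔇)) ⊆ σ(𝔇)`
  have hcomp : ((galRestrict A K L B σ : B →+* B).comp (galRestrict A K L B σ⁻¹ : B →+* B)) =
      RingHom.id B := by
    ext x
    simp only [RingHom.coe_comp, RingHom.coe_coe, Function.comp_apply, RingHom.id_apply]
    rw [← AlgEquiv.mul_apply, ← map_mul, mul_inv_cancel, map_one, AlgEquiv.one_apply]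
  calc differentIdeal A B
      = ((differentIdeal A B).map (galRestrict A K L B σ⁻¹)).map (galRestrict A K L B σ) := by
          rw [← Ideal.map_coe (galRestrict A K L B σ⁻¹), ← Ideal.map_coe (galRestrict A K L B σ),
            Ideal.map_map, hcomp, Ideal.map_id]
    _ ≤ (differentIdeal A B).map (galRestrict A K L B σ) := Ideal.map_mono (hle σ⁻¹)

omit [IsDomain A] [IsIntegrallyClosed A] [IsDedekindDomain B] [IsFractionRing B L]
  [Module.IsTorsionFree A B] [FiniteDimensional K L] in
/-- Pushing forward twice along `σ⁻¹` then `σ` is the identity on ideals of `B`. [folklore] -/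
private theorem map_galRestrict_map_galRestrict_inv (σ : L ≃ₐ[K] L) (I : Ideal B) :
    (I.map (galRestrict A K L B σ⁻¹)).map (galRestrict A K L B σ) = I := by
  have hcomp : ((galRestrict A K L B σ : B →+* B).comp (galRestrict A K L B σ⁻¹ : B →+* B)) =
      RingHom.id B := by
    ext x
    simp only [RingHom.coe_comp, RingHom.coe_coe, Function.comp_apply, RingHom.id_apply]
    rw [← AlgEquiv.mul_apply, ← map_mul, mul_inv_cancel, map_one, AlgEquiv.one_apply]
  rw [← Ideal.map_coe (galRestrict A K L B σ⁻¹), ← Ideal.map_coe (galRestrict A K L B σ),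
    Ideal.map_map, hcomp, Ideal.map_id]

/-- **Galois invariance of the different exponent** (extended multiplicity): for every ideal `P` of
`B` and `σ ∈ Aut(L/K)`, `ord_{σP}(𝔇_{B/A}) = ord_P(𝔇_{B/A})`.
[cite: SerreLocalFields1979, Ch. III §4 Prop. 8] -/
theorem emultiplicity_differentIdeal_map_galRestrict (σ : L ≃ₐ[K] L) (P : Ideal B) :
    emultiplicity (P.map (galRestrict A K L B σ)) (differentIdeal A B) =
      emultiplicity P (differentIdeal A B) := by
  refine le_antisymm ?_ ?_
  · -- push forward by `σ⁻¹`
    have h := le_emultiplicity_map (Ideal.mapHom (galRestrict A K L B σ⁻¹))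
      (a := P.map (galRestrict A K L B σ)) (b := differentIdeal A B)
    rw [Ideal.mapHom_apply, Ideal.mapHom_apply, map_galRestrict_differentIdeal] at h
    have hP : (P.map (galRestrict A K L B σ)).map (galRestrict A K L B σ⁻¹) = P := by
      have := map_galRestrict_map_galRestrict_inv A K L B σ⁻¹ P
      rwa [inv_inv] at this
    rwa [hP] at h
  · have h := le_emultiplicity_map (Ideal.mapHom (galRestrict A K L B σ))
      (a := P) (b := differentIdeal A B)
    rwa [Ideal.mapHom_apply, Ideal.mapHom_apply, map_galRestrict_differentIdeal] at h

/-- **Galois invariance of the different exponent** (`ℕ`-valued multiplicity).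
[cite: SerreLocalFields1979, Ch. III §4 Prop. 8] -/
theorem multiplicity_differentIdeal_map_galRestrict (σ : L ≃ₐ[K] L) (P : Ideal B) :
    multiplicity (P.map (galRestrict A K L B σ)) (differentIdeal A B) =
      multiplicity P (differentIdeal A B) :=
  multiplicity_eq_of_emultiplicity_eq (emultiplicity_differentIdeal_map_galRestrict A K L B σ P)

end AKLB

/-! ## Number fields: the exponent of `𝔇_{K/F}` is constant on the places over a fixed place of `F` -/

section NumberField

open NumberField IsDedekindDomain

variable (F K : Type*) [Field F] [NumberField F] [Field K] [NumberField K] [Algebra F K]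

/-- For number fields `F ⊆ K` and `σ ∈ Aut(K/F)`: `σ(𝔇_{K/F}) = 𝔇_{K/F}` (ideals of `𝓞 K`).
[cite: NeukirchANT1999, Ch. III §2] -/
theorem map_galRestrict_differentIdeal_ringOfIntegers (σ : K ≃ₐ[F] K) :
    (differentIdeal (𝓞 F) (𝓞 K)).map (galRestrict (𝓞 F) F K (𝓞 K) σ) = differentIdeal (𝓞 F) (𝓞 K) :=
  map_galRestrict_differentIdeal (𝓞 F) F K (𝓞 K) σ

/-- Mathlib's pointwise action of `σ ∈ Aut(K/F)` on ideals of `𝓞 K` is the pushforward along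
`galRestrict σ`. [folklore] -/
private theorem pointwise_smul_eq_map_galRestrict (σ : K ≃ₐ[F] K) (I : Ideal (𝓞 K)) :
    σ • I = I.map (galRestrict (𝓞 F) F K (𝓞 K) σ) := by
  have hfun : ∀ x : 𝓞 K, σ • x = galRestrict (𝓞 F) F K (𝓞 K) σ x := by
    intro x
    apply Subtype.ext
    change σ (x : K) = ((galRestrict (𝓞 F) F K (𝓞 K) σ x : 𝓞 K) : K)
    exact (algebraMap_galRestrict_apply (𝓞 F) σ x).symm
  ext y
  rw [Ideal.mem_map_of_equiv]
  constructor
  · intro hy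
    rw [Ideal.mem_pointwise_smul_iff_inv_smul_mem] at hy
    refine ⟨σ⁻¹ • y, hy, ?_⟩
    rw [← hfun, smul_inv_smul]
  · rintro ⟨x, hx, rfl⟩
    rw [← hfun]
    exact Ideal.smul_mem_pointwise_smul σ x I hx

/-- For number fields `F ⊆ K` and `σ ∈ Aut(K/F)`: `σ • 𝔇_{K/F} = 𝔇_{K/F}` for Mathlib's pointwise
action of `K ≃ₐ[F] K` on ideals of `𝓞 K`. [cite: NeukirchANT1999, Ch. III §2] -/
theorem smul_differentIdeal_ringOfIntegers (σ : K ≃ₐ[F] K) :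
    σ • differentIdeal (𝓞 F) (𝓞 K) = differentIdeal (𝓞 F) (𝓞 K) := by
  rw [pointwise_smul_eq_map_galRestrict, map_galRestrict_differentIdeal_ringOfIntegers]

/-- The exponent of `𝔇_{K/F}` is invariant under `σ ∈ Aut(K/F)`: `ord_{σ•P}(𝔇_{K/F}) = ord_P(𝔇_{K/F})`.
[cite: NeukirchANT1999, Ch. III §2] -/
theorem multiplicity_differentIdeal_smul (σ : K ≃ₐ[F] K) (P : Ideal (𝓞 K)) :
    multiplicity (σ • P) (differentIdeal (𝓞 F) (𝓞 K)) = multiplicity P (differentIdeal (𝓞 F) (𝓞 K)) := by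
  rw [pointwise_smul_eq_map_galRestrict]
  exact multiplicity_differentIdeal_map_galRestrict (𝓞 F) F K (𝓞 K) σ P

/-- **In a Galois extension `K/F` of number fields, the exponent of the relative different
`𝔇_{K/F}` is the same at all places of `K` over a given place of `F`** (conjugate places).
[cite: NeukirchANT1999, Ch. III §2] -/
theorem multiplicity_differentIdeal_eq_of_under_eq [IsGalois F K] (w w' : HeightOneSpectrum (𝓞 K))
    (h : w.asIdeal.under (𝓞 F) = w'.asIdeal.under (𝓞 F)) :
    multiplicity w.asIdeal (differentIdeal (𝓞 F) (𝓞 K)) =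
      multiplicity w'.asIdeal (differentIdeal (𝓞 F) (𝓞 K)) := by
  haveI : w.asIdeal.IsMaximal := w.isMaximal
  haveI : w'.asIdeal.IsMaximal := w'.isMaximal
  let G := K ≃ₐ[F] K
  haveI : IsGaloisGroup G (𝓞 F) (𝓞 K) := IsGaloisGroup.of_isFractionRing G (𝓞 F) (𝓞 K) F K
  haveI : w'.asIdeal.LiesOver (w.asIdeal.under (𝓞 F)) := ⟨h⟩
  obtain ⟨σ, hσ⟩ := Ideal.exists_smul_eq_of_isGaloisGroup (w.asIdeal.under (𝓞 F)) w.asIdeal w'.asIdeal G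
  rw [← hσ, multiplicity_differentIdeal_smul]

/-- Restricting scalars from `F` to `ℚ` does not change the pointwise action of `σ ∈ Aut(K/F)` on
ideals of `𝓞 K`. [folklore] -/
private theorem restrictScalars_rat_smul (σ : K ≃ₐ[F] K) (P : Ideal (𝓞 K)) :
    (σ.restrictScalars ℚ) • P = σ • P := by
  have h : MulSemiringAction.toRingHom (K ≃ₐ[ℚ] K) (𝓞 K) (σ.restrictScalars ℚ) =
      MulSemiringAction.toRingHom (K ≃ₐ[F] K) (𝓞 K) σ :=
    RingHom.ext fun x => Subtype.ext rfl
  rw [Ideal.pointwise_smul_def, h, ← Ideal.pointwise_smul_def]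

/-- The exponent of the ABSOLUTE different `𝔇_{K/ℤ}` is invariant under every `σ ∈ Aut(K/F)`
(`σ` is an automorphism of `K/ℚ`, and `𝔇_{K/ℤ} = 𝔇_{𝓞K/𝓞ℚ}`). [cite: NeukirchANT1999, Ch. III §2] -/
theorem multiplicity_absDifferent_smul (σ : K ≃ₐ[F] K) (P : Ideal (𝓞 K)) :
    multiplicity (σ • P) (differentIdeal ℤ (𝓞 K)) = multiplicity P (differentIdeal ℤ (𝓞 K)) := by
  rw [← restrictScalars_rat_smul F K σ P, differentIdeal_int_eq_differentIdeal_ringOfIntegers_rat]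
  exact multiplicity_differentIdeal_smul ℚ K (σ.restrictScalars ℚ) P

/-- **In a Galois extension `K/F` of number fields, the exponent of the absolute different `𝔇_{K/ℤ}`
is the same at all places of `K` over a given place of `F`** — hence so is the different exponent
`d(K_w) = ord_w(𝔇_{K/ℤ})/e(w|p)` of the completions ([IUTchIV] Prop. 1.1 "`d_i`") along the fibre.
[cite: NeukirchANT1999, Ch. III §2] -/
theorem multiplicity_absDifferent_eq_of_under_eq [IsGalois F K] (w w' : HeightOneSpectrum (𝓞 K))
    (h : w.asIdeal.under (𝓞 F) = w'.asIdeal.under (𝓞 F)) :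
    multiplicity w.asIdeal (differentIdeal ℤ (𝓞 K)) =
      multiplicity w'.asIdeal (differentIdeal ℤ (𝓞 K)) := by
  haveI : w.asIdeal.IsMaximal := w.isMaximal
  haveI : w'.asIdeal.IsMaximal := w'.isMaximal
  let G := K ≃ₐ[F] K
  haveI : IsGaloisGroup G (𝓞 F) (𝓞 K) := IsGaloisGroup.of_isFractionRing G (𝓞 F) (𝓞 K) F K
  haveI : w'.asIdeal.LiesOver (w.asIdeal.under (𝓞 F)) := ⟨h⟩
  obtain ⟨σ, hσ⟩ := Ideal.exists_smul_eq_of_isGaloisGroup (w.asIdeal.under (𝓞 F)) w.asIdeal w'.asIdeal G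
  rw [← hσ, multiplicity_absDifferent_smul]

/-- The ramification index over `ℤ` is likewise constant on the fibre (`e(w|p) = e(w|v)·e(v|p)` with
`e(w|v)` constant by Galois theory; recorded for the quotient `d(K_w) = ord_w(𝔇_{K/ℤ})/e(w|p)`).
[cite: NeukirchANT1999, Ch. I §9 (9.3), Ch. II (6.8)] -/
theorem ramificationIdx_int_eq_of_under_eq [IsGalois F K] (w w' : HeightOneSpectrum (𝓞 K))
    (h : w.asIdeal.under (𝓞 F) = w'.asIdeal.under (𝓞 F)) :
    w.asIdeal.ramificationIdx ℤ = w'.asIdeal.ramificationIdx ℤ := by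
  haveI : w.asIdeal.IsMaximal := w.isMaximal
  haveI : w'.asIdeal.IsMaximal := w'.isMaximal
  let G := K ≃ₐ[F] K
  haveI : IsGaloisGroup G (𝓞 F) (𝓞 K) := IsGaloisGroup.of_isFractionRing G (𝓞 F) (𝓞 K) F K
  haveI : w'.asIdeal.LiesOver (w.asIdeal.under (𝓞 F)) := ⟨h⟩
  have hrel : w.asIdeal.ramificationIdx (𝓞 F) = w'.asIdeal.ramificationIdx (𝓞 F) :=
    Ideal.ramificationIdx_eq_of_isGaloisGroup (w.asIdeal.under (𝓞 F)) w.asIdeal w'.asIdeal G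
  rw [Ideal.ramificationIdx_tower (R := ℤ) (w.asIdeal.under (𝓞 F)) w.asIdeal,
    Ideal.ramificationIdx_tower (R := ℤ) (w'.asIdeal.under (𝓞 F)) w'.asIdeal, hrel, h]

end NumberField

end Literature.NumberTheory.NumberFields
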